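import Literature.MathematicalPhysics.QuantumFieldTheory.DimockYuan2024.FieldTranslationNorm
import HarnessLib

/-!
# Dimock–Yuan, *Structural stability of the RG flow in the Gross–Neveu model*, §2.4 (52) and LEMMA 14 (271) with (275):
# the norm of the field variation `δE(X,ψ,η) = E(X,ψ+η) − E(X,ψ)` —
# `‖δE(X)‖_{½h,h′} ≤ r⁻¹‖E(X)‖_{½h+rh′}` (275) and `‖δE‖_{½h,¼h,Γ} ≤ O(1)‖E‖_{h,Γ}` (271) — PROVED (finite generator sets)

statement-level skeleton of published theorems with citation tags; proofs where landed; nothing here is a claim about the Yang–Mills mass gap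

**Citation header (reproduction of PUBLISHED work).** J. Dimock, C. Yuan, *Structural stability of the RG flow in the
Gross–Neveu model*, Ann. Henri Poincaré **25** (2024) 5113–5186 (= arXiv:2303.07916v3) [DimockYuan2024GNFlow]: §2.4
(51)–(52) p.9 L60 – p.10 L9 and **LEMMA 14** (271), its proof (273)–(275), p.41 L22–47 of the held text layer
`paper:arxiv-2303.07916` (`p.NN Lnn` = PDF page ∕ text-layer line). Writer seat p11 (literature-prover-lit-balaban-p11-g16-0),
YM LIT SWEEP item (c) D10; continues `FieldTranslationNorm.lean` (seat p11 gen 15: the two-parameter norm `‖·‖_{h,h′}` (112)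
and LEMMA 9 (120) `‖F⁺‖_{h,h′} = ‖F‖_{h+h′}` for `F⁺(ψ,η) = F(ψ+η)`).

**The printed text.** §2.4 (p.9 L60 – p.10 L9): *"We consider elements of the Grassmann algebra `G_h` which have the form
`E(ψ) = Σ_X E(X,ψ)` (51) where `E(X,ψ)` depends on `ψ` only in `X`. With a weight function `Γ(X)` we define a norm on the
family `E = {E(X)}` … by `‖E‖_{h,Γ} = Σ_{X ⊃ □} ‖E(X)‖_h Γ(X)` (52). Both `E(X)` and `Γ(X)` will be invariant under
translations by elements of `ℤ²`, so this is independent of the unit block `□`."* **LEMMA 14** (p.41 L22–29):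
*"`δE_k(X,ψ,η) = E_k(ψ+η) − E_k(ψ)` satisfies `‖δE_k‖_{½h,¼h,Γ_n} ≤ O(1)‖E_k‖_{h,Γ_n}` (271). Furthermore if `¼h > h(C)`,
`‖⟨δE_k⟩_C‖_{½h,Γ_n} ≤ O(1)h(C)h⁻¹‖E_k‖_{h,Γ_n}` (272)."* Proof (p.41 L30–47): *"Let `E⁺_k(X,u,ψ,η) ≡ E_k(X,ψ+uη)`. Then we
have the representation for `r > 1` `δE_k(X,ψ,η) = (1/2πi)∮_{|u|=r} du/(u(u−1)) E⁺_k(X,u,ψ,η)` (273). Indeed `E⁺_k(X,u,ψ,η)`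
is analytic in `u` … and for `|u| ≤ r` it satisfies by lemma 9 `‖E⁺_k(X,u)‖_{½h,h′} ≤ ‖E_k(X)‖_{½h+rh′}` (274) … This gives
the bound `‖δE_k(X)‖_{½h,h′} ≤ O(1)r⁻¹‖E_k(X)‖_{½h+rh′}` (275). For the first result we take `h′ = ¼h` and `r` slightly
less than `2`."*

**What is here (finite generator sets, the setting of `FieldTranslationNorm.lean`; everything PROVED, no named facts).**
* `embed F = F(ψ)` read in the algebra of `(ψ, η)` (= the tree's `QED3TorusI.mapFst`), `coeff_embed`;
  **`fieldVariation F = δF(ψ,η) = F(ψ+η) − F(ψ)`** (`= shift F − embed F`), `coeff_fieldVariation`;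
* `hNorm₂_fieldVariation` — in the monomial basis the variation norm is EXACTLY `‖δF‖_{h,h′} = ‖F‖_{h+h′} − ‖F‖_h`
  (the `η`-free monomials of `F⁺` are those of `F(ψ)`; LEMMA 9 for the rest);
* **`hNorm₂_fieldVariation_le` — (275) with `O(1) = 1`**: `‖δF‖_{h,h′} ≤ r⁻¹‖F‖_{h+rh′}` for `h, h′ ≥ 0`, `r ≥ 1`. The
  printed proof goes through the Cauchy formula (273); here, on finite generator sets, the same bound follows termwise from
  LEMMA 9's expansion: a monomial with `m ≥ 1` letters `η` has weight `h^n h′^m ≤ r⁻¹ h^n (rh′)^m` — a shorter road to the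
  printed inequality, stated with the explicit constant;
* **`hNorm₂_fieldVariation_half_quarter_le` — (271) for one `X`**: `‖δF‖_{½h,¼h} ≤ ½‖F‖_h` (`h′ = ¼h`, `r = 2`; the print
  takes *"`r` slightly less than `2`"* only because (274) needs `½h + rh′ ≤ h` with analyticity up to the circle);
* the family norms (52): `familyNorm h Γ □ E = Σ_{X ∋ □} ‖E(X)‖_h Γ(X)` and `familyNorm₂ h h′ Γ □ E` on the paved sets
  (finite unions of the finitely many unit blocks of a torus), and **`lemma14` — (271)**:
  `‖δE‖_{½h,¼h,Γ} ≤ ½‖E‖_{h,Γ}` for every non-negative weight `Γ` (e.g. `Γ_n` of (56), `WeightFunctionGamma.lean`).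
Not here: (272) (the fluctuation integral `⟨·⟩_C` in the `C′` norms), the Cauchy-formula route (273)–(274) itself.
-/

noncomputable section

open Finset

namespace Literature.MathematicalPhysics.QuantumFieldTheory.DimockYuan2024

namespace FieldVariationNorm

open Literature.MathematicalPhysics.QuantumLattice
open Literature.MathematicalPhysics.QuantumLattice.GrassmannAlgebra
open Literature.MathematicalPhysics.QuantumFieldTheory.Dimock2011to13.QED3TorusI
open Literature.MathematicalPhysics.QuantumFieldTheory.DimockYuan2024.FieldTranslationNorm

variable {𝕜 : Type*} [RCLike 𝕜] {ι : Type*} [LinearOrder ι] [Fintype ι]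

/-! ## `F(ψ)` and `δF(ψ,η) = F(ψ+η) − F(ψ)` in the algebra of the fields `(ψ, η)` -/

/-- `F(ψ)` regarded as a function of `(ψ, η)` not depending on `η`: the embedding of `Λ(ι)` as the first block of
`Λ(ι ⊕ₗ ι)` (the tree's `mapFst`). [cite: DimockYuan2024GNFlow, §4.1 Lemma 14 p.41 L22 («E_k(ψ+η) − E_k(ψ)»)] -/
abbrev embed : GrassmannAlgebra 𝕜 ι →ₐ[𝕜] GrassmannAlgebra 𝕜 (ι ⊕ₗ ι) :=
  mapFst (𝕜 := 𝕜) (ι₁ := ι) (ι₂ := ι)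

/-- **The field variation `δF(ψ,η) = F(ψ+η) − F(ψ)`.** [cite: DimockYuan2024GNFlow, §4.1 Lemma 14 (271) p.41 L22] -/
def fieldVariation (F : GrassmannAlgebra 𝕜 ι) : GrassmannAlgebra 𝕜 (ι ⊕ₗ ι) :=
  shift F - embed F

/-- `F(ψ)` on a monomial: `θ_S ↦ ψ(S)` (no `η`-letters). [cite: DimockYuan2024GNFlow, §4.1 Lemma 14 p.41 L22] -/
theorem embed_grassmannBasis (S : Finset ι) :
    embed (𝕜 := 𝕜) (grassmannBasis 𝕜 ι S) = grassmannBasis 𝕜 (ι ⊕ₗ ι) (split S S) := by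
  rw [embed, mapFst, map_extendByZero_grassmannBasis, split, Finset.sdiff_self, Finset.map_empty, Finset.union_empty]

omit [Fintype ι] in
/-- A monomial of `Λ(ι ⊕ₗ ι)` has no `η`-letters iff it is `ψ(S)` for `S` its `ψ`-letters. [folklore] -/
private theorem split_self_eq_iff (S : Finset ι) (T : Finset (ι ⊕ₗ ι)) [Fintype ι] :
    split S S = T ↔ sndPart T = ∅ ∧ S = fstPart T := by
  rw [split_eq_iff subset_rfl]
  constructor
  · rintro ⟨hd, rfl, hS⟩
    have h : sndPart T = ∅ := by
      have := Finset.union_eq_left.1 hS.symm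
      exact (Finset.disjoint_self_iff_empty _).1 (hd.mono_left this)
    exact ⟨h, by rw [hS, h, Finset.union_empty]⟩
  · rintro ⟨h, rfl⟩
    exact ⟨by rw [h]; exact disjoint_empty_right _, rfl, by rw [h, Finset.union_empty]⟩

/-- **The coefficients of `F(ψ)` in the `(ψ,η)` algebra**: `c_T = c_{T₁}(F)` on `η`-free monomials, `0` otherwise.
[cite: DimockYuan2024GNFlow, §4.1 Lemma 14 p.41 L22] -/
theorem coeff_embed (F : GrassmannAlgebra 𝕜 ι) (T : Finset (ι ⊕ₗ ι)) :
    coeff (embed F) T = if sndPart T = ∅ then coeff F (fstPart T) else 0 := by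
  classical
  have hF : F = ∑ S, coeff F S • grassmannBasis 𝕜 ι S := ((grassmannBasis 𝕜 ι).sum_repr F).symm
  conv_lhs => rw [hF]
  simp only [map_sum, map_smul, embed_grassmannBasis, coeff, Finsupp.finsetSum_apply, Finsupp.smul_apply,
    Module.Basis.repr_self, Finsupp.single_apply, smul_eq_mul, mul_ite, mul_one, mul_zero, split_self_eq_iff]
  by_cases h : sndPart T = ∅
  · simp only [h, true_and, if_true, Finset.sum_ite_eq', Finset.mem_univ]
  · simp only [h, false_and, if_false, Finset.sum_const_zero]

/-- Coefficients are additive. [folklore] -/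
private theorem coeff_sub (G G' : GrassmannAlgebra 𝕜 (ι ⊕ₗ ι)) (T : Finset (ι ⊕ₗ ι)) :
    coeff (G - G') T = coeff G T - coeff G' T := by
  simp only [coeff, map_sub, Finsupp.sub_apply]

/-- On `η`-free monomials `F⁺` and `F(ψ)` have the same coefficient `c_{T₁}(F)`. [cite: DimockYuan2024GNFlow, §2.3 (122) p.19 L62–70] -/
theorem coeff_shift_of_sndPart_eq_empty (F : GrassmannAlgebra 𝕜 ι) {T : Finset (ι ⊕ₗ ι)} (h : sndPart T = ∅) :
    coeff (shift F) T = coeff F (fstPart T) := by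
  rw [coeff_shift, if_pos (by rw [h]; exact disjoint_empty_right _), h, Finset.union_empty]
  have h0 : splitSign (fstPart T) (fstPart T) = 0 := by
    rw [splitSign, Finset.sdiff_self, Finset.product_empty, Finset.filter_empty, Finset.card_empty]
  rw [h0, pow_zero, one_mul]

/-- **The coefficients of `δF`**: zero on `η`-free monomials, those of `F⁺` otherwise.
[cite: DimockYuan2024GNFlow, §4.1 Lemma 14 (271) p.41 L22] -/
theorem coeff_fieldVariation (F : GrassmannAlgebra 𝕜 ι) (T : Finset (ι ⊕ₗ ι)) :
    coeff (fieldVariation F) T = if sndPart T = ∅ then 0 else coeff (shift F) T := by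
  rw [fieldVariation, coeff_sub, coeff_embed]
  split_ifs with h
  · rw [coeff_shift_of_sndPart_eq_empty F h, sub_self]
  · rw [sub_zero]

/-! ## The norm of the variation: (275) and (271) for one localized function -/

/-- The `η`-free part of `‖F⁺‖_{h,h′}` is `‖F‖_h`. [cite: DimockYuan2024GNFlow, §2.3 Lemma 9 (120)–(123) p.19 L20–80] -/
theorem sum_filter_sndPart_empty (h h' : ℝ) (F : GrassmannAlgebra 𝕜 ι) :
    ∑ T ∈ Finset.univ.filter (fun T : Finset (ι ⊕ₗ ι) => sndPart T = ∅),
      h ^ (fstPart T).card * h' ^ (sndPart T).card * ‖coeff (shift F) T‖ = hNorm h F := by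
  classical
  unfold hNorm
  refine Finset.sum_nbij' (fun T => fstPart T) (fun S => split S S) ?_ ?_ ?_ ?_ ?_
  · intro T _; exact Finset.mem_univ _
  · intro S _
    simp only [Finset.mem_filter, Finset.mem_univ, true_and, sndPart_split, Finset.sdiff_self]
  · intro T hT
    exact (split_self_eq_iff _ _).2 ⟨(Finset.mem_filter.1 hT).2, rfl⟩
  · intro S _
    exact fstPart_split S S
  · intro T hT
    have h0 : sndPart T = ∅ := (Finset.mem_filter.1 hT).2
    rw [coeff_shift_of_sndPart_eq_empty F h0, h0, Finset.card_empty, pow_zero, mul_one]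

/-- **`‖δF‖_{h,h′} = ‖F‖_{h+h′} − ‖F‖_h`** (every real `h, h′`): the variation norm counts exactly the monomials of
`F⁺ = F(ψ+η)` containing at least one `η`; LEMMA 9 counts all of them. [cite: DimockYuan2024GNFlow, §4.1 Lemma 14 (274)–(275) p.41 L35–45] -/
theorem hNorm₂_fieldVariation (h h' : ℝ) (F : GrassmannAlgebra 𝕜 ι) :
    hNorm₂ h h' (fieldVariation F) = hNorm (h + h') F - hNorm h F := by
  classical
  rw [← hNorm₂_shift h h' F, eq_sub_iff_add_eq, ← sum_filter_sndPart_empty h h' F]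
  unfold hNorm₂
  rw [← Finset.sum_filter_add_sum_filter_not Finset.univ (fun T : Finset (ι ⊕ₗ ι) => sndPart T = ∅)
    (fun T => h ^ (fstPart T).card * h' ^ (sndPart T).card * ‖coeff (shift F) T‖), add_comm]
  congr 1
  rw [← Finset.sum_filter_add_sum_filter_not Finset.univ (fun T : Finset (ι ⊕ₗ ι) => sndPart T = ∅)
    (fun T => h ^ (fstPart T).card * h' ^ (sndPart T).card * ‖coeff (fieldVariation F) T‖)]
  have h1 : ∑ T ∈ Finset.univ.filter (fun T : Finset (ι ⊕ₗ ι) => sndPart T = ∅),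
      h ^ (fstPart T).card * h' ^ (sndPart T).card * ‖coeff (fieldVariation F) T‖ = 0 := by
    refine Finset.sum_eq_zero fun T hT => ?_
    rw [coeff_fieldVariation, if_pos (Finset.mem_filter.1 hT).2, norm_zero, mul_zero]
  rw [h1, zero_add]
  refine Finset.sum_congr rfl fun T hT => ?_
  rw [coeff_fieldVariation, if_neg (Finset.mem_filter.1 hT).2]

/-- The variation norm is monotone in the `η`-weight with a gain `r⁻¹` from the guaranteed `η`:
`‖δF‖_{h,h′} ≤ r⁻¹ ‖δF‖_{h,rh′}` for `h, h′ ≥ 0`, `r ≥ 1`. [cite: DimockYuan2024GNFlow, §4.1 Lemma 14 (275) p.41 L43–45] -/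
theorem hNorm₂_fieldVariation_le_inv_mul {h h' r : ℝ} (hh : 0 ≤ h) (hh' : 0 ≤ h') (hr : 1 ≤ r)
    (F : GrassmannAlgebra 𝕜 ι) :
    hNorm₂ h h' (fieldVariation F) ≤ r⁻¹ * hNorm₂ h (r * h') (fieldVariation F) := by
  classical
  unfold hNorm₂
  rw [Finset.mul_sum]
  refine Finset.sum_le_sum fun T _ => ?_
  by_cases hT : sndPart T = ∅
  · rw [coeff_fieldVariation, if_pos hT, norm_zero, mul_zero, mul_zero, mul_zero]
  · have hm : 1 ≤ (sndPart T).card := Finset.card_pos.2 (Finset.nonempty_iff_ne_empty.2 hT)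
    have hr0 : 0 < r := lt_of_lt_of_le one_pos hr
    have key : h' ^ (sndPart T).card ≤ r⁻¹ * (r * h') ^ (sndPart T).card := by
      rw [mul_pow, ← mul_assoc]
      have h2 : (1 : ℝ) ≤ r⁻¹ * r ^ (sndPart T).card := by
        obtain ⟨m, hm'⟩ := Nat.exists_eq_add_of_le hm
        rw [hm', pow_add, pow_one, ← mul_assoc, inv_mul_cancel₀ hr0.ne', one_mul]
        exact one_le_pow₀ hr
      calc h' ^ (sndPart T).card = 1 * h' ^ (sndPart T).card := (one_mul _).symm
        _ ≤ (r⁻¹ * r ^ (sndPart T).card) * h' ^ (sndPart T).card :=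
          mul_le_mul_of_nonneg_right h2 (pow_nonneg hh' _)
    calc h ^ (fstPart T).card * h' ^ (sndPart T).card * ‖coeff (fieldVariation F) T‖
        ≤ h ^ (fstPart T).card * (r⁻¹ * (r * h') ^ (sndPart T).card) * ‖coeff (fieldVariation F) T‖ :=
          mul_le_mul_of_nonneg_right (mul_le_mul_of_nonneg_left key (pow_nonneg hh _)) (norm_nonneg _)
      _ = r⁻¹ * (h ^ (fstPart T).card * (r * h') ^ (sndPart T).card * ‖coeff (fieldVariation F) T‖) := by ring

/-- **(275) with the explicit constant `O(1) = 1`**: for `h, h′ ≥ 0` and `r ≥ 1`,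
`‖δF‖_{h,h′} ≤ r⁻¹ ‖F‖_{h+rh′}` (print: `‖δE_k(X)‖_{½h,h′} ≤ O(1)r⁻¹‖E_k(X)‖_{½h+rh′}`, any `h` in place of `½h`).
[cite: DimockYuan2024GNFlow, §4.1 Lemma 14 (275) p.41 L43–45] -/
theorem hNorm₂_fieldVariation_le {h h' r : ℝ} (hh : 0 ≤ h) (hh' : 0 ≤ h') (hr : 1 ≤ r) (F : GrassmannAlgebra 𝕜 ι) :
    hNorm₂ h h' (fieldVariation F) ≤ r⁻¹ * hNorm (h + r * h') F := by
  have hr0 : 0 < r := lt_of_lt_of_le one_pos hr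
  refine (hNorm₂_fieldVariation_le_inv_mul hh hh' hr F).trans ?_
  rw [hNorm₂_fieldVariation]
  refine mul_le_mul_of_nonneg_left ?_ (inv_nonneg.2 hr0.le)
  exact sub_le_self _ (hNorm_nonneg hh F)

/-- **(271) for one localized function**: `‖δF‖_{½h,¼h} ≤ ½‖F‖_h` (`h ≥ 0`; `h′ = ¼h`, `r = 2` in (275)).
[cite: DimockYuan2024GNFlow, §4.1 Lemma 14 (271) p.41 L22–25, L46] -/
theorem hNorm₂_fieldVariation_half_quarter_le {h : ℝ} (hh : 0 ≤ h) (F : GrassmannAlgebra 𝕜 ι) :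
    hNorm₂ (h / 2) (h / 4) (fieldVariation F) ≤ 1 / 2 * hNorm h F := by
  have h1 := hNorm₂_fieldVariation_le (h := h / 2) (h' := h / 4) (r := 2) (by linarith) (by linarith) (by norm_num) F
  have h2 : h / 2 + 2 * (h / 4) = h := by ring
  rw [h2] at h1
  simpa only [one_div] using h1

/-! ## The family norms (52) and LEMMA 14 (271) -/

section Family

variable {B : Type*} [Fintype B] [DecidableEq B]

/-- **The norm `‖E‖_{h,Γ} = Σ_{X ⊃ □} ‖E(X)‖_h Γ(X)` (52)** of a family `E = {E(X)}` of localized functions indexed by the paved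
sets `X` (finite unions of the unit blocks `B` of the torus), at the reference block `□`.
[cite: DimockYuan2024GNFlow, §2.4 (52) p.10 L1–9] -/
def familyNorm (h : ℝ) (Γ : Finset B → ℝ) (b : B) (E : Finset B → GrassmannAlgebra 𝕜 ι) : ℝ :=
  ∑ X ∈ Finset.univ.filter (fun X : Finset B => b ∈ X), hNorm h (E X) * Γ X

/-- The two-parameter family norm `‖E‖_{h,h′,Γ} = Σ_{X ⊃ □} ‖E(X)‖_{h,h′} Γ(X)` of a family of functions of `(ψ, η)`
(the norm on the left of (271)). [cite: DimockYuan2024GNFlow, §4.1 Lemma 14 (271) p.41 L22–25] -/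
def familyNorm₂ (h h' : ℝ) (Γ : Finset B → ℝ) (b : B) (E : Finset B → GrassmannAlgebra 𝕜 (ι ⊕ₗ ι)) : ℝ :=
  ∑ X ∈ Finset.univ.filter (fun X : Finset B => b ∈ X), hNorm₂ h h' (E X) * Γ X

/-- The family norms are monotone under a uniform bound on the members (non-negative weight). [folklore] -/
private theorem familyNorm₂_le_of_forall_le {h₁ h₁' h₂ c : ℝ} {Γ : Finset B → ℝ} (hΓ : ∀ X, 0 ≤ Γ X) (b : B)
    {E' : Finset B → GrassmannAlgebra 𝕜 (ι ⊕ₗ ι)} {E : Finset B → GrassmannAlgebra 𝕜 ι}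
    (hle : ∀ X, hNorm₂ h₁ h₁' (E' X) ≤ c * hNorm h₂ (E X)) :
    familyNorm₂ h₁ h₁' Γ b E' ≤ c * familyNorm h₂ Γ b E := by
  unfold familyNorm₂ familyNorm
  rw [Finset.mul_sum]
  refine Finset.sum_le_sum fun X _ => ?_
  rw [← mul_assoc]
  exact mul_le_mul_of_nonneg_right (hle X) (hΓ X)

/-- **LEMMA 14 (271)**: for a family `E = {E(X)}` of localized functions and `δE(X,ψ,η) = E(X,ψ+η) − E(X,ψ)`,
`‖δE‖_{½h,¼h,Γ} ≤ ½‖E‖_{h,Γ}` (`h ≥ 0`) for every non-negative weight `Γ` — in particular the printed `Γ_n` (56) — with the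
printed `O(1)` equal to `½` here. [cite: DimockYuan2024GNFlow, §4.1 Lemma 14 (271) p.41 L22–25] -/
theorem lemma14 {h : ℝ} (hh : 0 ≤ h) {Γ : Finset B → ℝ} (hΓ : ∀ X, 0 ≤ Γ X) (b : B)
    (E : Finset B → GrassmannAlgebra 𝕜 ι) :
    familyNorm₂ (h / 2) (h / 4) Γ b (fun X => fieldVariation (E X)) ≤ 1 / 2 * familyNorm h Γ b E :=
  familyNorm₂_le_of_forall_le hΓ b fun X => hNorm₂_fieldVariation_half_quarter_le hh (E X)

/-- (275) for families: `‖δE‖_{h,h′,Γ} ≤ r⁻¹‖E‖_{h+rh′,Γ}` (`h, h′ ≥ 0`, `r ≥ 1`, `Γ ≥ 0`).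
[cite: DimockYuan2024GNFlow, §4.1 Lemma 14 (275) p.41 L43–45] -/
theorem familyNorm₂_fieldVariation_le {h h' r : ℝ} (hh : 0 ≤ h) (hh' : 0 ≤ h') (hr : 1 ≤ r) {Γ : Finset B → ℝ}
    (hΓ : ∀ X, 0 ≤ Γ X) (b : B) (E : Finset B → GrassmannAlgebra 𝕜 ι) :
    familyNorm₂ h h' Γ b (fun X => fieldVariation (E X)) ≤ r⁻¹ * familyNorm (h + r * h') Γ b E :=
  familyNorm₂_le_of_forall_le hΓ b fun X => hNorm₂_fieldVariation_le hh hh' hr (E X)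

end Family

end FieldVariationNorm

end Literature.MathematicalPhysics.QuantumFieldTheory.DimockYuan2024
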